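import Summits.Ventures.AbcSig.Conjectures.LevelRaising32L2Instance313R8
import Summits.Ventures.AbcSig.Recipes.FreyTraceModels
import Summits.Ventures.AbcSig.Sieve.Eisenstein

/-!
# Venture AbcSig — Frey-side local data of `E₁(S)` at `313` and `223` for the open instance `(313; 23)` (PROVED; one COMPUTED datum)

HONEST FRAMING. Support file of the computation cell `pub-abcsig` (p-lean g21; lead g20 KEY «LR32-313-SYMPL»,
HOME/wake/KEY-pub-abcsig-p-lean-LR32-313-SYMPL.md; READ FIRST the module docstrings of `Conjectures/LevelRaising32L2Instance313R8.lean`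
(p539869: `CONJ_LR32_L2At_313_iff₈`, the typed EIGHT-class residual `LR32Residual313E` = NEGATIVE-21's open set `m ∈ {±6, ±10} (mod 23)` ×
`{D1, D2}`) and `Levels/N10016QCurve.lean` (p510507: the ℚ-curve `E/ℚ(i)` of record behind orbit `10016.1`)). PART (A) OF TWO. The cell's
SYMPL chain (HOME/STRUCTURE.md §8b (au), v3.29: «inside ((H), (H_id), Lemma 1′) the SYMPL survivor set of Q(313; 23) is `m ∈ {6, −10}`»)
compares the mod-23 Galois module of the Frey curve `E₁(S)` of a putative solution `S` with that of `E` at two places of `ℚ(i)`: a prime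
above `313` (MULTIPLICATIVE reduction on both sides; criterion [KO92, Prop. 2] = [FK16, Thm. 13], printed over `ℚ_ℓ`, here `ℚ(i)_π = ℚ₃₁₃`
since `313 = (12 + 13i)(12 − 13i)` splits) and the inert prime `223` (GOOD reduction, Frobenius non-semisimple mod 23: the «223 datum»).
THIS FILE PROVES THE FREY-SIDE INPUTS of both comparisons, for every putative datum `S` at once, in the tree's vocabulary (`FreyDatum`,
`freyTrace`, `CongruentToFrey`, `bs04Allowed`); part (B) (`Conjectures/LevelRaising32L2Instance313Sympl.lean`) takes the two criteria's
OUTPUTS as named TYPED hypotheses and draws the consequence for the residual's conclusion.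

WHAT IS PROVED (no hypothesis beyond those displayed in each signature; labels in the cell's words).
* `e1CurveInt S` — the printed curve `E₁(a, b, c) : Y² = X³ + 2cC·X² + BC·bⁿ·X` [BS04, p. 27] over `ℤ` (Mathlib `WeierstrassCurve ℤ`);
  `e1CurveInt_map`: its reduction modulo `q` IS the tree's `bs04Curve .E1 S q` (`Recipes/FreyTraceModels.lean`); `e1CurveInt_c₄`,
  `e1CurveInt_Δ` (Mathlib's `c₄`, `Δ`); `e1CurveInt_Δ_eq`: **[BS04, Lemma 2.1(a)] PROVED** — `Δ(E₁) = 2⁶·C³·B²·A·(a b²)ⁿ` under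
  `A aⁿ + B bⁿ = C c²`.
* AT `313` (`C = 1`, `gcd(A, B) = 1`, `A·B = 313^m`): `padicValInt_e1CurveInt_Δ` (`v_p(Δ) = v_p(A) + 2·v_p(B) + n·(v_p(a) + 2·v_p(b))`
  at any odd prime `p`); `val313_distributions`, `val313_e1CurveInt_Δ` (for `n = 23`: `v₃₁₃(Δ) ∈ m + 23ℕ` [distribution `(313^m, 1)`]
  or `∈ 2m + 23ℕ` [`(1, 313^m)`]); `dvd_val313_iff` (`23 ∣ v₃₁₃(Δ) ↔ 23 ∣ m` — the proviso «`p ∤ v_ℓ(Δ_m)`» of the multiplicative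
  criterion); `legendreNaive_val313` (`(3·v₃₁₃(Δ) / 23) = (m / 23)` — with `v_π(Δ_m(E)) = 3` at `π = 12 + 13i` (record `L313QCurve.E_Δ`,
  p510507) the criterion's symbol `((v_π(Δ_m(E₁)) / v_π(Δ_m(E))) / 23) = (3·v₃₁₃(Δ(E₁)) / 23)` IS `(m/23)`; at `π̄` (`v = 6`) the same
  symbol results because `(2/23) = +1` — kernel table `legendreNaive_23_three_six`; `legendreNaive 23` = Euler's criterion, the tree's
  computable Legendre symbol, = `quadraticChar (ZMod 23)` by `legendreNaive_eq_quadraticChar`); `e1CurveInt_multiplicative_313`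
  (`313 ∤ c₄(E₁(S))` and `313 ∣ Δ(E₁(S))` from primitivity, BOTH distributions: the printed integral model is minimal at `313` with
  MULTIPLICATIVE reduction — at both places of `ℚ(i)` above `313`, the curve being defined over `ℚ`) — i.e. exactly the Frey-side
  hypotheses of [KO92, Prop. 2] = [FK16, Thm. 13] as printed («E and E′ … with multiplicative reduction … Assume further that
  `p ∤ v_ℓ(Δ_m)`. Then … symplectically isomorphic ⇔ `((v_ℓ(Δ_m)/v_ℓ(Δ′_m)) / p) = 1`», HOME/lit/FK-symplectic-criteria-asprinted-lit-g27.md §1).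
* AT `223`: `frey223_of_congruentToFrey` — for `f` of level `2⁵·313` MATCHING the computed datum `lr32X313c` and ANY datum `S` with
  `A aⁿ + B bⁿ = C c²`, `223 ∤ ABC` and `CongruentToFrey M f 23 .E1 S` (`Conjectures/LevelRaising32L2.lean`): (i) `223 ∤ ab` — the
  level-lowering ESCAPE IS CLOSED in the kernel (`ψ(c₂₂₃) = ±224` contradicts `ψ(c₂₂₃)² = ψ(θ²) = 18`, as `224² ≡ 13 (mod 23)`);
  (ii) **`a₂₂₃(E₁(S)) = freyTrace .E1 S 223 = ±8`** — from `a₂₂₃² ≡ 18 (mod 23)` and `a₂₂₃ ∈ bs04Allowed 223` ([BS04, Lemma 4.2], PROVED in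
  the tree as `freyTrace_mem_bs04Allowed`: the rational `2`-torsion point `(0, 0)` + HASSE — `Literature.NumberTheory.EllipticCurves.HasseElementary`,
  Manin's elementary proof, sorry-free) via the kernel table `bs04Allowed_223_sq_eighteen` (`a = ±15`, which would give the CM order in
  `ℚ(√−667)`, is excluded exactly by parity); `frey223_parabolic`: `a₂₂₃² − 4·223 = −23·6²` and trace `a₂₂₃² − 2·223 = −382` over `𝔽₂₂₃²`
  (the residue field of `ℚ(i)` at the inert `223`) — EVERY putative solution reduces at `223` into the registrar's parabolic family cell
  (Frobenius order of conductor `6` in `ℚ(√−23)`; the «18-class» cell of HOME/lead/decisive-places-lead-g19/, blind second bench g34), with no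
  enumeration. (This is the Frey half of the 223 datum; the other half — the relative symplectic type `+1` of that cell against `E` — is
  COMPUTED by three hands and DERIVED from the law P28e, NOT proved: hypothesis `HS223` of part (B).)

THE ONE COMPUTED DATUM. `lr32X313c` = orbit `10016.1` (`F = x² − 18`, `θ = c₇`, the presentation of `orbit_10016_1` / `lr32X313`) with
`c₂₂₃ = θ` (θ-coordinates `[0, 1]` of `orbits[10016.1].c[223]` in the Sturm-complete engine-1 level file `census/levels-sturm/N10016.engine1.json`,
sha256 `00b4b490f47c12983f4d40a3375f9b035490bb819445f9bbf8c632e3184c3320`); so `a(E mod 223·ℤ[i]) = c₂₂₃² − 2·223 = −428`, the value of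
record (registrar / engine-1 g25). That the newforms matching `orbit_10016_1` also match `lr32X313c` is the hypothesis `hX223` of part (B) —
COMPUTED (engine-1 level file `00b4b490…`), not proved; same kind as `hX` of p525413. Only `c₂₂₃² = 18` is used.

WHAT THIS IS NOT. No symplectic criterion is formalised here or in part (B) (Mathlib has no `E[p]` as a Galois module and no Weil pairing
over number fields): the two criteria enter part (B) as TYPED hypotheses. Nothing here decides `LR32Residual313E`, Q(313; 23), or anything
about ABC or any summit; no row of the paper; the statements of record (p525413, p539869, `CONJ_LR32_L2`) are untouched. MEANINGFUL ONLY
FOR THE INTENDED MODEL wherever `NewformModel` appears.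

References: [BS04] M. A. Bennett, C. M. Skinner, Canad. J. Math. 56 (2004) 23–54, p. 27, Lemma 2.1, Lemma 4.2; [KO92] A. Kraus,
J. Oesterlé, *Sur une question de B. Mazur*, Math. Ann. 293 (1992) 259–275, Prop. 2 (p. 261); [FK16] N. Freitas, A. Kraus, *On the
symplectic type of isomorphisms of the `p`-torsion of elliptic curves*, Mem. Amer. Math. Soc. 277 (2022) no. 1361 (arXiv:1607.01218),
Thm. 13; J. H. Silverman, *The Arithmetic of Elliptic Curves*, Thm. V.1.1 (Hasse). Cell records: HOME = run/shared/lean/pub/pub-abcsig/: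
STRUCTURE.md §8 / §8b (au)-ADDENDUM (SYMPL, v3.29–v3.31), lead/CONJ-LEAN-SPEC.md, lead/decisive-places-lead-g19/,
lit/FK-symplectic-criteria-asprinted-lit-g27.md, lit/FK-goodred-asprinted-lit-g30.md, plean/g20/README-g20.md, plean/g21/README-g21.md.
-/

set_option maxRecDepth 200000

namespace Summit.Ventures.AbcSig.Conjectures

open Summit.Ventures.AbcSig

/-! ## The printed curve `E₁(a, b, c)` over `ℤ` and its invariants -/

/-- The Frey curve `E₁(a, b, c) : Y² = X³ + 2cC·X² + BC·bⁿ·X` of [BS04, p. 27] (cases (i), (ii)) over `ℤ`, as Weierstrass data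
`⟨a₁, a₂, a₃, a₄, a₆⟩ = ⟨0, 2cC, 0, BC bⁿ, 0⟩`; its base change to `ZMod q` is the tree's `bs04Curve .E1 S q` (`e1CurveInt_map`). -/
def e1CurveInt (S : FreyDatum) : WeierstrassCurve ℤ :=
  ⟨0, 2 * S.c * S.C, 0, S.B * S.C * S.b ^ S.n, 0⟩

/-- The reduction of `e1CurveInt S` modulo `q` is the printed curve over `ZMod q` of `Recipes/FreyTraceModels.lean`. -/
theorem e1CurveInt_map (S : FreyDatum) (q : ℕ) :
    (e1CurveInt S).map (Int.castRingHom (ZMod q)) = bs04Curve .E1 S q := by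
  simp only [e1CurveInt, bs04Curve, WeierstrassCurve.map, eq_intCast]
  push_cast
  rfl

/-- `c₄(E₁) = 16·(4c²C² − 3·BC bⁿ)`. -/
theorem e1CurveInt_c₄ (S : FreyDatum) :
    (e1CurveInt S).c₄ = 16 * (4 * (S.c * (S.C : ℤ)) ^ 2 - 3 * ((S.B : ℤ) * S.C * S.b ^ S.n)) := by
  simp only [e1CurveInt, WeierstrassCurve.c₄, WeierstrassCurve.b₂, WeierstrassCurve.b₄]
  ring

/-- `Δ(E₁) = 16·(BC bⁿ)²·((2cC)² − 4·BC bⁿ)` (the discriminant of `Y² = X³ + a₂X² + a₄X` is `16 a₄² (a₂² − 4a₄)`). -/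
theorem e1CurveInt_Δ (S : FreyDatum) :
    (e1CurveInt S).Δ =
      16 * ((S.B : ℤ) * S.C * S.b ^ S.n) ^ 2 * ((2 * S.c * (S.C : ℤ)) ^ 2 - 4 * ((S.B : ℤ) * S.C * S.b ^ S.n)) := by
  simp only [e1CurveInt, WeierstrassCurve.Δ, WeierstrassCurve.b₂, WeierstrassCurve.b₄, WeierstrassCurve.b₆,
    WeierstrassCurve.b₈]
  ring

/-- **[BS04, Lemma 2.1(a)] for `E₁`, PROVED: `Δ(E₁(a, b, c)) = 2⁶·C³·B²·A·(a b²)ⁿ`** whenever `A aⁿ + B bⁿ = C c²`. -/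
theorem e1CurveInt_Δ_eq (S : FreyDatum) (heq : (S.A : ℤ) * S.a ^ S.n + S.B * S.b ^ S.n = S.C * S.c ^ 2) :
    (e1CurveInt S).Δ = 64 * (S.C : ℤ) ^ 3 * (S.B : ℤ) ^ 2 * S.A * (S.a ^ S.n * (S.b ^ S.n) ^ 2) := by
  rw [e1CurveInt_Δ]
  linear_combination (-64 * (S.B : ℤ) ^ 2 * (S.C : ℤ) ^ 3 * (S.b ^ S.n) ^ 2) * heq

/-! ## At `313`: multiplicative reduction, and `v₃₁₃(Δ)` modulo `23` -/

/-- **The valuation of `Δ(E₁)` at an odd prime `p`**, for `C = 1`: `v_p(Δ) = v_p(A) + 2·v_p(B) + n·(v_p(a) + 2·v_p(b))`. -/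
theorem padicValInt_e1CurveInt_Δ (S : FreyDatum) {p : ℕ} [hp : Fact p.Prime] (hp2 : p ≠ 2)
    (heq : (S.A : ℤ) * S.a ^ S.n + S.B * S.b ^ S.n = S.C * S.c ^ 2) (hC : S.C = 1)
    (hA : S.A ≠ 0) (hB : S.B ≠ 0) (ha : S.a ≠ 0) (hb : S.b ≠ 0) :
    padicValInt p (e1CurveInt S).Δ =
      padicValNat p S.A + 2 * padicValNat p S.B + S.n * (padicValInt p S.a + 2 * padicValInt p S.b) := by
  have hΔ : ((e1CurveInt S).Δ).natAbs = 64 * S.A * S.B ^ 2 * (S.a.natAbs ^ S.n * (S.b.natAbs ^ S.n) ^ 2) := by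
    rw [e1CurveInt_Δ_eq S heq, hC]
    simp only [Int.natAbs_mul, Int.natAbs_pow, Nat.cast_one, one_pow, mul_one, Int.natAbs_natCast]
    rw [show Int.natAbs 64 = 64 from rfl]
    ring
  have h64 : padicValNat p 64 = 0 := by
    refine padicValNat.eq_zero_of_not_dvd fun h => hp2 ?_
    exact (Nat.prime_dvd_prime_iff_eq hp.out Nat.prime_two).mp
      (hp.out.dvd_of_dvd_pow (show p ∣ 2 ^ 6 by simpa using h))
  have ha' : S.a.natAbs ≠ 0 := Int.natAbs_ne_zero.mpr ha
  have hb' : S.b.natAbs ≠ 0 := Int.natAbs_ne_zero.mpr hb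
  unfold padicValInt
  rw [hΔ, padicValNat.mul (by positivity) (by positivity), padicValNat.mul (by positivity) (by positivity),
    padicValNat.mul (by norm_num) hA, h64, padicValNat.pow, padicValNat.mul (by positivity) (by positivity),
    padicValNat.pow, padicValNat.pow, padicValNat.pow]
  ring

/-- **The two coprime distributions.** If `gcd(A, B) = 1` and `A·B = 313^m`, then `v₃₁₃(A) + 2·v₃₁₃(B)` is `m` (`313^m ‖ A`,
distribution `(313^m, 1)`) or `2m` (`313^m ‖ B`, distribution `(1, 313^m)`). -/
theorem val313_distributions (A B m : ℕ) (hco : Nat.Coprime A B) (hAB : A * B = 313 ^ m) :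
    padicValNat 313 A + 2 * padicValNat 313 B = m ∨ padicValNat 313 A + 2 * padicValNat 313 B = 2 * m := by
  haveI : Fact (Nat.Prime 313) := ⟨by norm_num⟩
  have hAB0 : A * B ≠ 0 := by rw [hAB]; positivity
  have hA : A ≠ 0 := fun h => hAB0 (by rw [h, zero_mul])
  have hB : B ≠ 0 := fun h => hAB0 (by rw [h, mul_zero])
  have hsum : padicValNat 313 A + padicValNat 313 B = m := by
    rw [← padicValNat.mul hA hB, hAB, padicValNat.prime_pow]
  by_cases h313A : 313 ∣ A
  · have h313B : ¬ 313 ∣ B := by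
      intro hB'
      have h1 : 313 ∣ Nat.gcd A B := Nat.dvd_gcd h313A hB'
      rw [Nat.Coprime.gcd_eq_one hco] at h1
      exact absurd (Nat.le_of_dvd one_pos h1) (by norm_num)
    rw [padicValNat.eq_zero_of_not_dvd h313B] at hsum ⊢
    exact Or.inl (by omega)
  · rw [padicValNat.eq_zero_of_not_dvd h313A] at hsum ⊢
    exact Or.inr (by omega)

/-- **`v₃₁₃(Δ(E₁)) mod 23` for the `E₁` classes of `(313; 23)`.** For a datum with `C = 1`, `gcd(A, B) = 1`, `A·B = 313^m`,
`abAB ≠ 0` and exponent `n = 23`: `v₃₁₃(Δ(E₁(S))) = m′ + 23·k` with `m′ ∈ {m, 2m}` — so `23 ∣ v₃₁₃(Δ)` iff `23 ∣ m`, and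
`(v₃₁₃(Δ)/23)`-type symbols depend on `m` only (next lemma). -/
theorem val313_e1CurveInt_Δ (S : FreyDatum) (m : ℕ) (hn : S.n = 23)
    (heq : (S.A : ℤ) * S.a ^ S.n + S.B * S.b ^ S.n = S.C * S.c ^ 2) (hC : S.C = 1)
    (hco : Nat.Coprime S.A S.B) (hAB : S.A * S.B = 313 ^ m) (ha : S.a ≠ 0) (hb : S.b ≠ 0) :
    ∃ k : ℕ, padicValInt 313 (e1CurveInt S).Δ = m + 23 * k ∨ padicValInt 313 (e1CurveInt S).Δ = 2 * m + 23 * k := by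
  haveI : Fact (Nat.Prime 313) := ⟨by norm_num⟩
  have hAB0 : S.A * S.B ≠ 0 := by rw [hAB]; positivity
  have hA : S.A ≠ 0 := fun h => hAB0 (by rw [h, zero_mul])
  have hB : S.B ≠ 0 := fun h => hAB0 (by rw [h, mul_zero])
  rw [padicValInt_e1CurveInt_Δ S (by norm_num) heq hC hA hB ha hb, hn]
  refine ⟨padicValInt 313 S.a + 2 * padicValInt 313 S.b, ?_⟩
  rcases val313_distributions S.A S.B m hco hAB with h | h <;> rw [h]
  · exact Or.inl rfl
  · exact Or.inr rfl

/-- The Legendre symbol `(·/23)` by Euler's criterion (the tree's `legendreNaive`) depends on the residue only. -/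
theorem legendreNaive_mod (q v : ℕ) : legendreNaive q v = legendreNaive q (v % q) := by
  unfold legendreNaive
  rw [Nat.mod_mod, Nat.pow_mod (v % q), Nat.mod_mod, ← Nat.pow_mod]

/-- Kernel table: `(3r/23) = (6r/23) = (r/23)` for every residue `r` (`(2/23) = (3/23) = +1`). -/
theorem legendreNaive_23_three_six : ∀ r : Fin 23,
    legendreNaive 23 (3 * r % 23) = legendreNaive 23 r ∧ legendreNaive 23 (6 * r % 23) = legendreNaive 23 r := by
  decide

/-- **The 313-adic symbol depends on `m` only: `(3·v₃₁₃(Δ(E₁(S))) / 23) = (m / 23)`** (both distributions; `(2/23) = (3/23) = +1`). -/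
theorem legendreNaive_val313 (S : FreyDatum) (m : ℕ) (hn : S.n = 23)
    (heq : (S.A : ℤ) * S.a ^ S.n + S.B * S.b ^ S.n = S.C * S.c ^ 2) (hC : S.C = 1)
    (hco : Nat.Coprime S.A S.B) (hAB : S.A * S.B = 313 ^ m) (ha : S.a ≠ 0) (hb : S.b ≠ 0) :
    legendreNaive 23 (3 * padicValInt 313 (e1CurveInt S).Δ) = legendreNaive 23 m := by
  obtain ⟨k, hk⟩ := val313_e1CurveInt_Δ S m hn heq hC hco hAB ha hb
  have h3 := (legendreNaive_23_three_six ⟨m % 23, Nat.mod_lt _ (by norm_num)⟩).1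
  have h6 := (legendreNaive_23_three_six ⟨m % 23, Nat.mod_lt _ (by norm_num)⟩).2
  simp only at h3 h6
  rw [legendreNaive_mod 23 m]
  rcases hk with h | h <;> rw [h, legendreNaive_mod]
  · rw [← h3]; congr 1; omega
  · rw [← h6]; congr 1; omega

/-- `23 ∣ v₃₁₃(Δ(E₁(S)))` iff `23 ∣ m` (the hypothesis `p ∤ v(Δ_min)` of the multiplicative symplectic criterion). -/
theorem dvd_val313_iff (S : FreyDatum) (m : ℕ) (hn : S.n = 23)
    (heq : (S.A : ℤ) * S.a ^ S.n + S.B * S.b ^ S.n = S.C * S.c ^ 2) (hC : S.C = 1)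
    (hco : Nat.Coprime S.A S.B) (hAB : S.A * S.B = 313 ^ m) (ha : S.a ≠ 0) (hb : S.b ≠ 0) :
    23 ∣ padicValInt 313 (e1CurveInt S).Δ ↔ 23 ∣ m := by
  obtain ⟨k, hk⟩ := val313_e1CurveInt_Δ S m hn heq hC hco hAB ha hb
  rcases hk with h | h <;> rw [h] <;> omega

/-- **`E₁(S)` has MULTIPLICATIVE reduction at `313` on its printed (hence minimal at `313`) model**: for a primitive solution
with `C = 1`, `A·B = 313^m`, `m ≥ 1`: `313 ∤ c₄(E₁(S))` and `313 ∣ Δ(E₁(S))` — at both places `π, π̄` of `ℚ(i)` above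
`313 = ππ̄` alike (the curve is defined over `ℚ`). This is the Frey-side INPUT of the multiplicative symplectic criterion
[KO92, Prop. 2] = [FK, Thm. 13]; the ℚ-curve side is the tree's `L313QCurve.E_Δ` (`v_π(Δ) = 3`, `v_π̄(Δ) = 6`). -/
theorem e1CurveInt_multiplicative_313 (S : FreyDatum) (m : ℕ) (hm : 1 ≤ m)
    (hsol : IsPrimitiveSolution S.A S.B S.C S.n S.a S.b S.c) (hC : S.C = 1) (hAB : S.A * S.B = 313 ^ m) :
    ¬ (313 : ℤ) ∣ (e1CurveInt S).c₄ ∧ (313 : ℤ) ∣ (e1CurveInt S).Δ := by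
  obtain ⟨heq, -, -, -, -, hac, hbc⟩ := hsol
  have hp : Prime (313 : ℤ) := Nat.prime_iff_prime_int.mp (by norm_num)
  have h313AB : 313 ∣ S.A ∨ 313 ∣ S.B := (Nat.Prime.dvd_mul (by norm_num)).mp
    (hAB ▸ dvd_pow_self 313 (by omega))
  have hunit : ¬ IsUnit (313 : ℤ) := by rw [Int.isUnit_iff]; omega
  -- `313 ∣ c` is incompatible with primitivity in either distribution
  have hc_of_sq : (313 : ℤ) ∣ 16 * S.c ^ 2 → (313 : ℤ) ∣ S.c := fun h => by
    rcases hp.dvd_or_dvd h with h | h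
    · exact absurd h (by decide)
    · exact hp.dvd_of_dvd_pow h
  refine ⟨fun hc4 => ?_, ?_⟩
  · rw [e1CurveInt_c₄, hC] at hc4
    push_cast at hc4
    simp only [mul_one] at hc4
    rw [hC] at heq
    push_cast at heq
    simp only [one_mul] at heq
    rcases h313AB with hA | hB
    · -- `313 ∣ A`: `c₄ = 16(c² + 3 A aⁿ)`
      have hA' : (313 : ℤ) ∣ (S.A : ℤ) := Int.natCast_dvd_natCast.mpr hA
      have h1 : (313 : ℤ) ∣ 16 * S.c ^ 2 := by
        have h2 : (313 : ℤ) ∣ 48 * ((S.A : ℤ) * S.a ^ S.n) := Dvd.dvd.mul_left (Dvd.dvd.mul_right hA' _) _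
        have h3 := Dvd.dvd.sub hc4 h2
        have hrw : 16 * (4 * S.c ^ 2 - 3 * ((S.B : ℤ) * S.b ^ S.n)) - 48 * ((S.A : ℤ) * S.a ^ S.n)
            = 16 * S.c ^ 2 := by linear_combination (-48) * heq
        rwa [hrw] at h3
      have hc := hc_of_sq h1
      exact hunit (hac.isUnit_of_dvd' (Dvd.dvd.mul_right hA' _) (by rw [hC]; push_cast; simpa using hc))
    · -- `313 ∣ B`: `c₄ ≡ 64 c² (mod 313)`
      have hB' : (313 : ℤ) ∣ (S.B : ℤ) := Int.natCast_dvd_natCast.mpr hB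
      have h1 : (313 : ℤ) ∣ 16 * S.c ^ 2 := by
        have h2 : (313 : ℤ) ∣ 48 * ((S.B : ℤ) * S.b ^ S.n) := Dvd.dvd.mul_left (Dvd.dvd.mul_right hB' _) _
        have h3 := Dvd.dvd.add hc4 h2
        have hrw : 16 * (4 * S.c ^ 2 - 3 * ((S.B : ℤ) * S.b ^ S.n)) + 48 * ((S.B : ℤ) * S.b ^ S.n)
            = 4 * (16 * S.c ^ 2) := by ring
        rw [hrw] at h3
        rcases hp.dvd_or_dvd h3 with h | h
        · exact absurd h (by decide)
        · exact h
      have hc := hc_of_sq h1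
      exact hunit (hbc.isUnit_of_dvd' (Dvd.dvd.mul_right hB' _) (by rw [hC]; push_cast; simpa using hc))
  · rw [e1CurveInt_Δ_eq S heq]
    rcases h313AB with hA | hB
    · exact Dvd.dvd.mul_right (Dvd.dvd.mul_left (Int.natCast_dvd_natCast.mpr hA) _) _
    · have hB' : (313 : ℤ) ∣ (S.B : ℤ) ^ 2 := dvd_pow (Int.natCast_dvd_natCast.mpr hB) two_ne_zero
      exact Dvd.dvd.mul_right (Dvd.dvd.mul_right (Dvd.dvd.mul_left hB' _) _) _

/-! ## At `223`: the one computed datum, the closed escape, and the trace `±8` -/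

/-- **COMPUTED DATUM** (the file's only external input): orbit `10016.1` (`F = x² − 18`, `θ = c₇`, the presentation of
`orbit_10016_1` and of `lr32X313`) carries `c₂₂₃ = θ` — θ-coordinates `[0, 1]` of `orbits[10016.1].c[223]` in the Sturm-complete
engine-1 level file `HOME/census/levels-sturm/N10016.engine1.json` (sha256 `00b4b490f47c12983f4d40a3375f9b035490bb819445f9bbf8c632e3184c3320`).
That the newforms matching `orbit_10016_1` also match it is the COMPUTED hypothesis `hX223` wherever taken (same kind as `hX` of
`…Instance313.lean`, checkable with plean/g6/gen6/thetaverify.py). Only `c₂₂₃² = 18` is used below. -/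
def lr32X313c : OrbitData :=
  { F := [-18, 0, 1], coeffs := [⟨223, 1, [0, 1]⟩] }

/-- The entry of `lr32X313c` is at an odd prime not dividing the level `2⁵·313`. -/
theorem lr32X313c_wellformed : ∀ e ∈ lr32X313c.coeffs, e.ell.Prime ∧ e.ell ≠ 2 ∧ ¬ e.ell ∣ 2 ^ 5 * 313 := by
  decide

/-- Kernel table: among the [BS04, Lemma 4.2] values at `223` (`±224` and the even `t` with `t² ≤ 892`), `t² ≡ 18 (mod 23)` holds
exactly for `t = ±8`. (`±224`: `224² ≡ 13`; `±15` would need an odd trace.) -/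
theorem bs04Allowed_223_sq_eighteen : ∀ t ∈ bs04Allowed 223, (t * t - 18) % 23 = 0 → t = 8 ∨ t = -8 := by
  decide +kernel

/-- **The 223 datum on the Frey side, PROVED.** Let `f` be a newform of level `2⁵·313` matching the computed datum `lr32X313c`
(`c₂₂₃(f) = θ`, `θ² = 18`), and `S = (A, B, C; n; a, b, c)` a datum with `A aⁿ + B bⁿ = C c²`, `223 ∤ ABC`, whose curve `E₁(S)` is
congruent to `f` above `23` (`CongruentToFrey M f 23 .E1 S`). Then (i) the level-lowering ESCAPE IS CLOSED: `223 ∤ ab` — otherwise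
`ψ(c₂₂₃) = ±224` while `ψ(c₂₂₃)² = ψ(θ²) = 18` and `224² ≡ 13 ≢ 18 (mod 23)`; (ii) `E₁(S)` has good reduction at `223` with
**`a₂₂₃(E₁(S)) = ±8`**: `ψ(c₂₂₃) = a₂₂₃` gives `a₂₂₃² ≡ 18 (mod 23)`, and `a₂₂₃ ∈ bs04Allowed 223` ([BS04, Lemma 4.2] PROVED in the
tree: `freyTrace_mem_bs04Allowed` = the rational `2`-torsion point + HASSE, `Literature…HasseElementary`) leaves `±8` only
(`bs04Allowed_223_sq_eighteen`). Hence `a₂₂₃² − 4·223 = −23·6²`: Frobenius at `223` generates the order of conductor `6` in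
`ℚ(√−23)`, and over `𝔽₂₂₃²` (the residue field of `ℚ(i)` at the inert prime `223`) the trace is `a₂₂₃² − 2·223 = −382` — every putative
solution reduces into the registrar's parabolic family cell of the 223 datum (HOME/STRUCTURE.md §8b; lead/decisive-places-lead-g19/). -/
theorem frey223_of_congruentToFrey (M : NewformModel) (f : M.Form (2 ^ 5 * 313)) (hf : M.Matches f lr32X313c)
    (S : FreyDatum) (heq : (S.A : ℤ) * S.a ^ S.n + S.B * S.b ^ S.n = S.C * S.c ^ 2)
    (hA : ¬ (223 : ℤ) ∣ (S.A : ℤ)) (hB : ¬ 223 ∣ S.B) (hC : ¬ 223 ∣ S.C) (h : CongruentToFrey M f 23 .E1 S) :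
    ¬ (223 : ℤ) ∣ S.a * S.b ∧ (freyTrace .E1 S 223 = 8 ∨ freyTrace .E1 S 223 = -8) := by
  obtain ⟨k, hk, hchar, ψ, hψ⟩ := h
  obtain ⟨θ, hF, hcoef⟩ := hf
  obtain ⟨hmult, hgood⟩ := hψ 223 (by norm_num) (by norm_num) (by norm_num) (by norm_num)
  -- `θ² = 18` and `c₂₂₃ = θ`
  have hθ : θ * θ = 18 := by
    have h0 := hF
    simp only [lr32X313c, evalL_cons, evalL_nil] at h0
    push_cast at h0
    linear_combination h0
  have hc : M.eig (2 ^ 5 * 313) f 223 = θ := by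
    have h0 := hcoef ⟨223, 1, [0, 1]⟩ (by simp [lr32X313c])
    simp only [evalL_cons, evalL_nil] at h0
    push_cast at h0
    simpa using h0
  have hψsq : ψ (M.eig (2 ^ 5 * 313) f 223) * ψ (M.eig (2 ^ 5 * 313) f 223) = 18 := by
    rw [hc, ← map_mul, hθ, map_ofNat]
  -- every admissible `t` with `ψ(c₂₂₃) = t` satisfies `t² ≡ 18 (mod 23)`, hence `t = ±8`
  have key : ∀ t : ℤ, t ∈ bs04Allowed 223 → ψ (M.eig (2 ^ 5 * 313) f 223) = (t : k) → t = 8 ∨ t = -8 := by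
    intro t ht hψt
    refine bs04Allowed_223_sq_eighteen t ht (Int.emod_eq_zero_of_dvd ?_)
    refine (CharP.intCast_eq_zero_iff k 23 _).mp ?_
    push_cast
    rw [← hψt, hψsq, sub_self]
  have hab : ¬ (223 : ℤ) ∣ S.a * S.b := by
    intro hab
    rcases hmult hab with h1 | h1
    · have := key ((223 : ℕ) + 1 : ℤ) (succ_mem_bs04Allowed 223) (by simpa using h1)
      omega
    · have := key (-((223 : ℕ) + 1 : ℤ)) (neg_succ_mem_bs04Allowed 223) (by simpa using h1)
      omega
  have ha : ¬ (223 : ℤ) ∣ S.a := fun h1 => hab (Dvd.dvd.mul_right h1 _)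
  have hb : ¬ (223 : ℤ) ∣ S.b := fun h1 => hab (Dvd.dvd.mul_left h1 _)
  exact ⟨hab, key _ (freyTrace_mem_bs04Allowed .E1 S (by norm_num) (by norm_num) heq hA hB hC ha hb) (hgood hab)⟩

/-- Corollary: the Frobenius discriminant at `223` is `a₂₂₃² − 4·223 = −828 = −23·6²` and the trace over `𝔽₂₂₃²` is `−382`. -/
theorem frey223_parabolic (M : NewformModel) (f : M.Form (2 ^ 5 * 313)) (hf : M.Matches f lr32X313c)
    (S : FreyDatum) (heq : (S.A : ℤ) * S.a ^ S.n + S.B * S.b ^ S.n = S.C * S.c ^ 2)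
    (hA : ¬ (223 : ℤ) ∣ (S.A : ℤ)) (hB : ¬ 223 ∣ S.B) (hC : ¬ 223 ∣ S.C) (h : CongruentToFrey M f 23 .E1 S) :
    freyTrace .E1 S 223 ^ 2 - 4 * 223 = -23 * 6 ^ 2 ∧ freyTrace .E1 S 223 ^ 2 - 2 * 223 = -382 := by
  rcases (frey223_of_congruentToFrey M f hf S heq hA hB hC h).2 with h8 | h8 <;> rw [h8] <;> norm_num

end Summit.Ventures.AbcSig.Conjectures
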